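import Literature.NumberTheory.NumberFields.NonGaloisQuarticCMFieldRoots
import Literature.FieldTheory.Galois.EvenQuarticGaloisGroup
import HarnessLib

/-!
# The Galois group of `X⁴ + 6X² + 7` (the census carrier `K = ℚ(√−(3+√2))`) as Mathlib's `Polynomial.Gal`:
# dihedral of order `8`

Topic `NumberTheory/NumberFields`; namespace `Literature.NumberTheory.NumberFields.NonGaloisQuarticCM`.  Theorem-only
bridge (no definition, no named fact, no `sorry`) between the tree's polynomial `NonGaloisQuarticCM.quartic =
X ^ 4 + 6 * X ^ 2 + 7` (`NonGaloisQuarticCMFieldRoots.lean`; root field `KD = ℚ[X]/(quartic) ≅ ℚ(√−(3+√2))`, the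
non-Galois quartic CM field of the COR-CM census) and the general Kappe–Warren / Dummit–Foote §14.6 Exercise 13
criterion of `Literature/FieldTheory/Galois/EvenQuarticGaloisGroup.lean` (`EvenQuartic.irreducible_and_gal_dihedral_X4_6X2_7`,
stated there for `X ^ 4 + C 6 * X ^ 2 + C 7`): **`Gal(quartic) ≃* DihedralGroup 4`** and `|Gal(quartic)| = 8`.  The tree
already has the same group as `Gal(N/ℚ)` for the normal closure `N ⊂ ℂ` of `KD`
(`NonGaloisQuarticCM.nonempty_dihedralGroup_mulEquiv_gal_normalClosure_KD`, `NonGaloisQuarticCMFieldNormalClosure.lean`);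
here it is Mathlib's `Polynomial.Gal` (automorphisms of `quartic.SplittingField`), obtained from `8 = 6² − 4·7`,
`7`, `56 = 7·8 ∉ ℚ²`.

## References

* D. S. Dummit, R. M. Foote, *Abstract Algebra*, 3rd ed. (2004), §14.6 Exercise 13 (b)(iii). [DummitFoote2004]
* L.-C. Kappe, B. Warren, *An elementary test for the Galois group of a quartic polynomial*, Amer. Math. Monthly 96
  (1989) 133–137. [KappeWarren1989]

## Provenance

Cell `pub-hodgecm2` (COR-CM census carrier), literature seat `lit-deligne-2` gen 52 (count-neutral, theorems only).
-/

noncomputable section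

open Polynomial

namespace Literature.NumberTheory.NumberFields.NonGaloisQuarticCM

/-- `quartic = X⁴ + 6X² + 7` written with constant coefficients `C 6`, `C 7` (the shape used by
`Literature.FieldTheory.Galois.EvenQuartic`). [folklore] -/
private theorem quartic_eq_C : quartic = X ^ 4 + C 6 * X ^ 2 + C 7 := by
  rw [quartic, ← map_ofNat C 6, ← map_ofNat C 7]

/-- **`Gal(X⁴ + 6X² + 7) ≃* DihedralGroup 4`**: the Galois group (Mathlib's `Polynomial.Gal`, automorphisms of the
splitting field) of the defining polynomial of the census carrier `K = ℚ(√−(3+√2))` is dihedral of order `8`, by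
Dummit–Foote §14.6 Exercise 13 (b)(iii) / Kappe–Warren with `a = 6`, `b = 7`: `b = 7` and `b(a² − 4b) = 56` are not
rational squares. [cite: DummitFoote2004, §14.6 Exercise 13 (b)(iii)] -/
theorem nonempty_gal_quartic_mulEquiv_dihedralGroup : Nonempty (quartic.Gal ≃* DihedralGroup 4) := by
  rw [quartic_eq_C]
  exact Literature.FieldTheory.Galois.EvenQuartic.irreducible_and_gal_dihedral_X4_6X2_7.2

/-- **`|Gal(X⁴ + 6X² + 7)| = 8`.** [cite: DummitFoote2004, §14.6 Exercise 13 (b)(iii)] -/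
theorem natCard_gal_quartic : Nat.card quartic.Gal = 8 := by
  obtain ⟨e⟩ := nonempty_gal_quartic_mulEquiv_dihedralGroup
  rw [Nat.card_congr e.toEquiv, DihedralGroup.nat_card]

/-- **The splitting field of `X⁴ + 6X² + 7` has degree `8` over `ℚ`** (the Galois closure of the non-Galois quartic
`K`; cf. `[N : ℚ] = 8` for `N ⊂ ℂ` in `NonGaloisQuarticCMFieldNormalClosure.lean`).
[cite: DummitFoote2004, §14.6 Exercise 13 (b)(iii)] -/
theorem finrank_splittingField_quartic : Module.finrank ℚ quartic.SplittingField = 8 := by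
  rw [← Gal.card_of_separable quartic_irreducible.separable, natCard_gal_quartic]

end Literature.NumberTheory.NumberFields.NonGaloisQuarticCM
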